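import Mathlib

/-!
# Critic certificate (stub-critic g33) for card `stub-heegnerindexloweratwo-k2-g32` (node R193)

The card computes the three local groups `Z = H²_Iw(ℚ₂^cyc/ℚ₂, T⁻)`, `ZΔ = H²_Iw(ℚ₂^cyc/ℚ₂, T_Δ)
= H²_Iw(ℚ₂(μ_{2^∞})/ℚ₂, T)`, `Z₁ = H²_Iw(ℚ₂^cyc/ℚ₂, T)` for `T = T(key) = ℤ₂(β^{ur}·θ·υ^c)`
and claims all three are `ℤ/2` for EVERY key.  By local duality each is the Pontryagin dual of
`((ℚ₂/ℤ₂)(χ))^{G}` for the relevant character `χ` and group `G ∈ {G_{ℚ₂^cyc}, G_{ℚ₂(μ_{2^∞})}}`;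
`χ` factors through `𝒢 = ℤ₂ˣ × ℤ₂` (coordinates `(s, f)` = (cyclotomic, unramified)), the image of
`G_{ℚ₂^cyc}` is topologically generated by `(−1, 0)` and `(1, 1)`, that of `G_{ℚ₂(μ_{2^∞})}` by
`(1, 1)`, and the generator VALUES are
  `ρ⁻¹(1,1) = ε·β⁻¹` (`ε = υ^c(Frob) = (−1)^c` — the Fin 2 coordinate of the key, LIVE here),
  `ρ⁻¹(−1,0) = −θ(−1)`, `(ρ⁻¹χ₄)(−1,0) = θ(−1)`.
The invariants of `(ℚ₂/ℤ₂)(χ)` under units `u_i` are `(ℚ₂/ℤ₂)[2^m]`, `m = min v₂(u_i − 1)`; we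
certify `m` in the truncation `ℤ/16 ⊇ (ℚ₂/ℤ₂)[2^m]` (`m ≤ 2 < 4`), with `β⁻¹ ≡ 3 (mod 16)`
(§1).  RESULT (§2): `(#Z, #ZΔ, #Z₁) = (2,2,2)` for the three keys with `c = 0` (card ✓), but
`(2,4,4)` for `e ∈ {−1,−2}, c = 1` and `(4,4,2)` for `e = 2, c = 1` (card ✗: «χ_e = 1 on
G_{ℚ₂(μ_{2^n})}» drops `υ^c`).  The cokernel COUNT is nevertheless key-uniform:
`#coker(d₂) = #Z·#Z₁/#ZΔ = 2` (§3, the corrected receptacle: `coker d₂ ≃ ker ι`, not `≃ Z`), and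
the card's `DescHyps` (needs `ZΔ ≃ Z₁`) cannot be instantiated at the key `e = 2, c = 1` (§4).
§5: the kernel defect stays `≤ 1` bit because a 2-torsion subquotient of a CYCLIC group has
order `∣ 2` (the card's reason «⊆ ℤ/2» is wrong for `c = 1`, the bound survives).
BSD is not proved by any of this; nothing closes.
-/

set_option linter.dupNamespace false

namespace Summit.BirchSwinnertonDyer.BirchSwinnertonDyer.Cruxes.SplitBadTwoLowerHalfOfFacts.CriticK2G32

/-! ## §1  `β = ψ_{49a1}(𝔮̄)`: the unit root of `x² − x + 2` (`a₂(49a1) = 1`) mod 16 -/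

/-- The roots of `x² − x + 2` in `ℤ/16` are `6` (even) and `11` (odd): hence the 2-adic unit root
satisfies `β ≡ 11 (mod 16)`, `β⁻¹ ≡ 3 (mod 16)`, `v₂(β − 1) = 1`, `v₂(β + 1) = 2`. -/
theorem unitRoot_mod16 : ∀ x : ZMod 16, x * x - x + 2 = 0 → (x = 6 ∨ x = 11) := by decide

theorem betaInv_mod16 : (11 : ZMod 16) * 3 = 1 := by decide

/-! ## §2  Invariants in the truncation `(ℚ₂/ℤ₂)[16] = ℤ/16` -/

/-- The three ramified twist classes and the unramified sign (`c : Bool`): SIX keys. -/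
inductive TwistE | neg1 | two | neg2
  deriving DecidableEq, Repr

instance : Fintype TwistE := ⟨{.neg1, .two, .neg2}, by intro x; cases x <;> simp⟩

/-- `θ(−1)` for `θ ∈ {χ₄, χ₈, χ₈'}` (`e = −1, 2, −2`). -/
def thetaNegOne : TwistE → ZMod 16
  | .neg1 => -1
  | .two  => 1
  | .neg2 => -1

/-- `ε = υ^c(Frob)`. -/
def eps : Bool → ZMod 16
  | false => 1
  | true  => -1

/-- `#((ℤ/16)^{⟨u_i⟩})` with `u_i` acting by multiplication. -/
def fixedCard (us : List (ZMod 16)) : ℕ :=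
  (Finset.univ.filter fun a : ZMod 16 => ∀ u ∈ us, u * a = a).card

/-- `#Z_Δ = #H²_Iw(ℚ₂(μ_{2^∞})/ℚ₂, T(key))` — generator value `ε β⁻¹`. -/
def cardZD (e : TwistE) (c : Bool) : ℕ := let _ := e; fixedCard [eps c * 3]
/-- `#Z₁ = #H²_Iw(ℚ₂^cyc/ℚ₂, T(key))` — generator values `ε β⁻¹`, `−θ(−1)`. -/
def cardZ1 (e : TwistE) (c : Bool) : ℕ := fixedCard [eps c * 3, -thetaNegOne e]
/-- `#Z = #H²_Iw(ℚ₂^cyc/ℚ₂, T(key) ⊗ χ₄)` — generator values `ε β⁻¹`, `θ(−1)`. -/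
def cardZ (e : TwistE) (c : Bool) : ℕ := fixedCard [eps c * 3, thetaNegOne e]

/-- The corrected table `(#Z, #ZΔ, #Z₁)` per key. -/
theorem table :
    (∀ e, (cardZ e false, cardZD e false, cardZ1 e false) = (2, 2, 2)) ∧
    (cardZ .neg1 true, cardZD .neg1 true, cardZ1 .neg1 true) = (2, 4, 4) ∧
    (cardZ .neg2 true, cardZD .neg2 true, cardZ1 .neg2 true) = (2, 4, 4) ∧
    (cardZ .two true, cardZD .two true, cardZ1 .two true) = (4, 4, 2) := by decide

/-- The card's claim «all three `H²_Iw` are `ℤ/2` for every key» is false (three of six keys). -/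
theorem not_all_two : ¬ ∀ e c, cardZD e c = 2 := by decide

/-- … but the cokernel COUNT is key-uniform: `#Z · #Z₁ = 2 · #ZΔ` for all six keys. -/
theorem coker_count_uniform : ∀ e c, cardZ e c * cardZ1 e c = 2 * cardZD e c := by decide

/-! ## §3  The corrected receptacle: `coker d₂ ≃ ker ι` and the order count -/

section Count

variable {R : Type*} [CommRing R] {Mc M Z ZΔ Z₁ : Type*}
  [AddCommGroup Mc] [Module R Mc] [AddCommGroup M] [Module R M] [AddCommGroup Z] [Module R Z]
  [AddCommGroup ZΔ] [Module R ZΔ] [AddCommGroup Z₁] [Module R Z₁]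

/-- `coker(d₂ : M_cyc → M) ≃ ker(ι : H²_Iw(T⁻) → H²_Iw(T_Δ))` from exactness at `M` and at `Z`
(no hypothesis on `ν`; this replaces the card's `DescHyps.coker_equiv`, which needs `ι = 0`). -/
noncomputable def cokerEquivKer (d₂ : Mc →ₗ[R] M) (δ : M →ₗ[R] Z) (ι : Z →ₗ[R] ZΔ)
    (hMδ : LinearMap.range d₂ = LinearMap.ker δ) (hδι : LinearMap.range δ = LinearMap.ker ι) :
    (M ⧸ LinearMap.range d₂) ≃ₗ[R] LinearMap.ker ι :=
  ((Submodule.quotEquivOfEq _ _ hMδ).trans δ.quotKerEquivRange).trans (LinearEquiv.ofEq _ _ hδι)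

/-- Key-uniform count: `#coker(d₂) · #H²_Iw(T_Δ) = #H²_Iw(T⁻) · #H²_Iw(T)` for the exact tail
`M → Z → ZΔ → Z₁ → 0` (`Nat.card`; infinite groups count as `0`, no finiteness needed). -/
theorem card_coker_mul_card (d₂ : Mc →ₗ[R] M) (δ : M →ₗ[R] Z) (ι : Z →ₗ[R] ZΔ)
    (ν : ZΔ →ₗ[R] Z₁) (hMδ : LinearMap.range d₂ = LinearMap.ker δ)
    (hδι : LinearMap.range δ = LinearMap.ker ι) (hιν : LinearMap.range ι = LinearMap.ker ν)
    (hν : Function.Surjective ν) :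
    Nat.card (M ⧸ LinearMap.range d₂) * Nat.card ZΔ = Nat.card Z * Nat.card Z₁ := by
  have h1 : Nat.card (M ⧸ LinearMap.range d₂) = Nat.card (LinearMap.ker ι) :=
    Nat.card_congr (cokerEquivKer d₂ δ ι hMδ hδι).toEquiv
  have h2 : Nat.card Z = Nat.card (LinearMap.ker ι) * Nat.card (LinearMap.range ι) := by
    rw [Submodule.card_eq_card_quotient_mul_card (LinearMap.ker ι),
      Nat.card_congr ι.quotKerEquivRange.toEquiv]
  have h3 : Nat.card ZΔ = Nat.card (LinearMap.ker ν) * Nat.card (LinearMap.range ν) := by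
    rw [Submodule.card_eq_card_quotient_mul_card (LinearMap.ker ν),
      Nat.card_congr ν.quotKerEquivRange.toEquiv]
  have h4 : Nat.card (LinearMap.range ν) = Nat.card Z₁ := by
    rw [LinearMap.range_eq_top.mpr hν]
    exact Nat.card_congr (Submodule.topEquiv (R := R) (M := Z₁)).toEquiv
  rw [h1, h3, h2, hιν, h4]; ring

end Count

/-! ## §4  The card's `DescHyps` is not instantiable at the key `e = 2, c = 1` -/

/-- `DescHyps.equiv_ZΔ_Z₁ : Nonempty (ZΔ ≃ Z₁)` fails for `(#ZΔ, #Z₁) = (4, 2)`. -/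
theorem no_equiv_four_two : ¬ Nonempty (ZMod 4 ≃ ZMod 2) := by
  rintro ⟨e⟩
  have h := Fintype.card_congr e
  simp [ZMod.card] at h

/-- Concrete model of the `(4,4,2)` tail: `ι = 2· : ℤ/4 → ℤ/4`, `ν = ℤ/4 ↠ ℤ/2`; `ν` is onto but
not injective, `ι ≠ 0`, `#ker ι = 2 = #coker d₂ < 4 = #Z`. -/
theorem model_442 :
    Function.Surjective (ZMod.castHom (show 2 ∣ 4 by norm_num) (ZMod 2)) ∧
    ¬ Function.Injective (ZMod.castHom (show 2 ∣ 4 by norm_num) (ZMod 2)) ∧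
    (Finset.univ.filter fun a : ZMod 4 => (2 : ZMod 4) * a = 0).card = 2 := by
  refine ⟨ZMod.castHom_surjective _, ?_, by decide⟩
  intro hinj
  have h := hinj (a₁ := 0) (a₂ := 2) (by decide)
  exact absurd h (by decide)

/-! ## §5  Kernel defect: a 2-torsion subquotient of a cyclic group has order `∣ 2` -/

/-- Why `ker d₂ / (c−1)M_cyc` still has order `≤ 2` for `c = 1` although `Z₁ ≅ ℤ/4` there: it is
killed by `2` (Tate `Ĥ⁻¹(Δ, ·)`, the card's `two_smul_eq_sub_of_norm_zero`) AND a subquotient of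
the cyclic group `Z₁`. -/
theorem card_dvd_two_of_subquotient_cyclic {A : Type*} [AddCommGroup A] [IsAddCyclic A]
    (D : AddSubgroup A) (C : AddSubgroup (A ⧸ D)) (h2 : ∀ c : C, (2 : ℕ) • c = 0) :
    Nat.card C ∣ 2 := by
  haveI : IsAddCyclic (A ⧸ D) :=
    isAddCyclic_of_surjective (QuotientAddGroup.mk' D) (QuotientAddGroup.mk'_surjective D)
  rw [← IsAddCyclic.exponent_eq_card]
  exact AddMonoid.exponent_dvd_of_forall_nsmul_eq_zero h2

end Summit.BirchSwinnertonDyer.BirchSwinnertonDyer.Cruxes.SplitBadTwoLowerHalfOfFacts.CriticK2G32
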